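import Mathlib
import Literature.Computability.AlgebraicComplexity.BirkhoffShadow
import Literature.Computability.AlgebraicComplexity.BirkhoffShadowLowerBound
import Summits.ValiantsHypothesis.ValiantsHypothesis.Theses.DivisionGap

/-!
# Sketch — crux ShadowBirkhoff (stmt-ValiantsHypothesis-5069), crux-ideate round 1, ideator 1

First lemmas of the idea cards `parabola-register-face` (Lever A) and
`blocker-multiplexed-odometer` (Lever B).  Statements only (sorried); they must elaborate.
-/

noncomputable section

open Literature.Computability.AlgebraicComplexity

namespace Summit.ValiantsHypothesis.ValiantsHypothesis.Cruxes.ShadowBirkhoff.Ideator1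

/-! ## Shared geometric lemmas -/

/-- **Face monotonicity of shadow complexity** (both cards).  If `F` is the face of the finite
point set `S` cut out by maximising a linear functional `c`, then some planar projection of `S`
has at least half as many hull vertices as any planar projection of `F`
(tilt: `L' = (±M·c + L₁, L₂)` for `M` large; the vertices of `L(F)` exposed by directions with
`±u₁ > 0` survive). -/
theorem shadow_face_half {n : ℕ} (S : Set (Fin n × Fin n → ℝ)) (hS : S.Finite)
    (c : (Fin n × Fin n → ℝ) →ₗ[ℝ] ℝ) (L : (Fin n × Fin n → ℝ) →ₗ[ℝ] (Fin 2 → ℝ)) :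
    ∃ L' : (Fin n × Fin n → ℝ) →ₗ[ℝ] (Fin 2 → ℝ),
      (Set.extremePoints ℝ (convexHull ℝ (L '' {x ∈ S | ∀ y ∈ S, c y ≤ c x}))).ncard ≤
        2 * (Set.extremePoints ℝ (convexHull ℝ (L' '' S))).ncard := by
  sorry

/-- **Parabola criterion** (Lever A).  If two linear functionals satisfy `(b x)² ≤ a x` on a
finite set `S`, then every value `t` attained as `b x = t, a x = t²` gives a distinct vertex
`(t, t²)` of the shadow of `S` under `x ↦ (b x, a x)` (strict convexity of `t ↦ t²`:
`(t,t²)` is the unique maximiser of `y ↦ 2t·y₀ − y₁` over points with `y₁ ≥ y₀²`). -/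
theorem parabola_vertices {V : Type*} [AddCommGroup V] [Module ℝ V] (S : Set V) (hS : S.Finite)
    (a b : V →ₗ[ℝ] ℝ) (h : ∀ y ∈ S, (b y) ^ 2 ≤ a y) :
    {t : ℝ | ∃ x ∈ S, b x = t ∧ a x = t ^ 2}.ncard ≤
      (Set.extremePoints ℝ (convexHull ℝ ((fun x => (![b x, a x] : Fin 2 → ℝ)) '' S))).ncard := by
  sorry

/-- **Discrete convex chain** (Lever B, and the general form behind the parabola criterion).
Points `p 0, …, p T` with strictly increasing abscissae and strictly increasing slopes are all
vertices of their convex hull. -/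
theorem lowerChain_extreme (T : ℕ) (p : ℕ → Fin 2 → ℝ)
    (hx : ∀ t < T, p t 0 < p (t + 1) 0)
    (hslope : ∀ t, t + 1 < T + 1 → 0 < t →
      (p t 1 - p (t - 1) 1) * (p (t + 1) 0 - p t 0) < (p (t + 1) 1 - p t 1) * (p t 0 - p (t - 1) 0)) :
    ∀ t ≤ T, p t ∈ (convexHull ℝ (p '' Set.Iic T)).extremePoints ℝ := by
  sorry

/-! ## Lever A: the register/parabola face -/

/-- A **counter face of order `m` inside `DS_N`**: a 0/1 pattern `G` and two weight tables
`wa, wb` such that along every permutation supported in `G` the `a`-weight dominates the square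
of the `b`-weight, with equality realised at (at least) `2^m` distinct `b`-values.  (Intended
instance: `m` rigid "bit" cycles with `b`-weights `2^k`, `a`-weights `4^k`, and monotone-AND
pool gadgets with `a`-weight `2^{k+l+1}` on the product edge.) -/
def CounterFace (m N : ℕ) : Prop :=
  ∃ (G : Set (Fin N × Fin N)) (wa wb : Fin N × Fin N → ℝ),
    (∀ ρ : Equiv.Perm (Fin N), (∀ j, (ρ j, j) ∈ G) →
        (∑ j, wb (ρ j, j)) ^ 2 ≤ ∑ j, wa (ρ j, j)) ∧
    2 ^ m ≤ {t : ℝ | ∃ ρ : Equiv.Perm (Fin N), (∀ j, (ρ j, j) ∈ G) ∧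
        ∑ j, wb (ρ j, j) = t ∧ ∑ j, wa (ρ j, j) = t ^ 2}.ncard

/-- **Lever A reduction.**  Polynomial-size counter faces give the crux: with `N = m^d`,
`σ(DS_N) ≥ 2^m / 2` by `parabola_vertices` + `shadow_face_half` (the supported permutations form
the face of `DS_N` maximising `X ↦ Σ_{(i,j) ∈ G} X_{ij}`), and `2^{n^{1/d}}/4` is eventually larger
than `2^{(log₂ n + c)^c}`; monotonicity in `n` again by `shadow_face_half` (fix diagonal entries). -/
theorem shadowBirkhoff_of_counterFace (d : ℕ) (h : ∀ m : ℕ, 1 ≤ m → CounterFace m (m ^ d)) :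
    Summit.ValiantsHypothesis.ValiantsHypothesis.Theses.DivisionGap.ShadowBirkhoff := by
  sorry

/-! ## Lever B: two interacting tokens (generalising `BirkhoffShadowLower.embed`) -/

open BirkhoffShadowLower in
/-- **Two-token embedding.**  For a layered graph `G` on rows `< W` and `ν ≥ 2 + (|G|+1)·W`
there is a linear `L : ℝ^{ν×ν} → ℝ²` such that every PAIR of column-wise vertex-disjoint walks
(from rows `0` and `1`) has the sum of its cost pairs realised by a permutation matrix (two cycles
through two extra vertices `s₀, s₁`), and every permutation matrix either realises such a pair or is
expensive at every bounded parameter.  The disjointness constraint is the coupling resource of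
Lever B: which walks the second token may use depends on the first token's walk. -/
theorem embed₂ {ν : ℕ} (G : List Layer) (W : ℕ) (hW0 : 1 < W)
    (hW : ∀ l ∈ G, ∀ x y, l.adj x y → x < W ∧ y < W) (hν : 2 + (G.length + 1) * W ≤ ν)
    (Λ M₀ : ℝ) :
    ∃ L : (Fin ν × Fin ν → ℝ) →ₗ[ℝ] (Fin 2 → ℝ),
      (∀ p q, IsWalk G 0 p → IsWalk G 1 q → (∀ i < G.length, p.getD i 0 ≠ q.getD i 0) →
        ∃ X ∈ permMatrixPoints ν,
          L X = ![(cost G 0 p).1 + (cost G 1 q).1, (cost G 0 p).2 + (cost G 1 q).2]) ∧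
      (∀ X ∈ permMatrixPoints ν,
        (∃ p q, IsWalk G 0 p ∧ IsWalk G 1 q ∧ (∀ i < G.length, p.getD i 0 ≠ q.getD i 0) ∧
          L X = ![(cost G 0 p).1 + (cost G 1 q).1, (cost G 0 p).2 + (cost G 1 q).2]) ∨
        ∀ t : ℝ, |t| ≤ Λ → M₀ ≤ L X 0 + t * L X 1) := by
  sorry


/-! ## Card `coherence-lp-dual-certificates`: shadow vertices from a family of dual certificates -/

open BirkhoffShadowLower in
/-- **Dual certificates ⇒ shadow vertices.**  If `K` permutations `M k` come with slopes `t k` and potentials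
`(y k, z k)` that are dual-feasible for the cost table `wa − 2·t k·wb` and complementary-slack EXACTLY on the graph of
`M k`, and the `wb`-values of the `M k` are pairwise distinct, then the shadow of `DS_N` under
`X ↦ (⟨wb, X⟩, ⟨wa, X⟩)` has at least `K` vertices (each `M k` is the unique optimal assignment for its cost table, hence
its image is the unique minimiser of `p ↦ p₁ − 2 t_k p₀` over the image, hence extreme).  For a FIXED template
`(M, t, wb)` the hypotheses are a finite system of linear (in)equalities in `(wa, y, z)` — the coherence LP. -/
theorem vertices_of_dual_certificates {N K : ℕ} (wa wb : Fin N → Fin N → ℝ)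
    (M : Fin K → Equiv.Perm (Fin N)) (t : Fin K → ℝ) (y z : Fin K → Fin N → ℝ)
    (hslack : ∀ k i j, y k i + z k j ≤ wa i j - 2 * t k * wb i j)
    (htight : ∀ k i j, (y k i + z k j = wa i j - 2 * t k * wb i j ↔ j = M k i))
    (hdist : ∀ k k', ∑ i, wb i (M k i) = ∑ i, wb i (M k' i) → k = k') :
    K ≤ birkhoffShadowVertexCount (Lmap (ν := N) (fun u w => (wb u w, wa u w))) := by
  sorry

end Summit.ValiantsHypothesis.ValiantsHypothesis.Cruxes.ShadowBirkhoff.Ideator1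

end
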